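import Summits.NavierStokesRegularity.NavierStokesRegularity.Theorems.TypeIDSSLiouvilleConjecture
import Literature.Analysis.FluidPDE.TypeIAncientMild
import Literature.Analysis.FluidPDE.TypeIAncientMildRssPullback
import HarnessLib

/-!
# `SymmetricLiouville` (crux stmt-NavierStokesRegularity-4053), line `blowdown-kills-pitch`,
# stub T7 `stub_rssCoreOfConjecture`: the bridge from the canonical Type-I DSS Liouville conjecture
# to the Type-I rotated-self-similar core

Support file (everything proved, kind = proof) for the lead's skeleton of the line
`blowdown-kills-pitch` of the crux
`Summit.NavierStokesRegularity.NavierStokesRegularity.Theses.SymmetryModuliCount.SymmetricLiouville`.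
Statement (verbatim the registered stub T7): ASSUMING the canonical open conjecture
`Summit.NavierStokesRegularity.NavierStokesRegularity.TypeIDSSLiouvilleConjecture`
(`∀ c, TypeIDSSLiouville c ∧ ∀ R, RotatedTypeIDSSLiouville c R`; Bradshaw–Tsai 2017, §5, Open
Problem 5.1 = Tsai GSM 192, Conjectures 8.8–8.9), every element `u` of the Type-I ancient mild class
`A_C` (`IsTypeIAncientMild C u`) on `ℝ³` which is annihilated on `t < 0` by a rotated scaling
generator about the space–time origin, `∇u·(x + Ax) + u + 2t∂ₜu − Au = 0` with `A` skew, and which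
obeys a space–time Type-I bound `‖u(t,x)‖ ≤ K/(‖x‖ + √(−t))` (`HasTypeIDecay K u`), vanishes
identically on `t < 0`. The theorem is CONDITIONAL on the conjecture (taken as an explicit
hypothesis, never asserted).

## Proof

1. *Integrate the clause along the group* (`rss_pull_const` with vertex `θ = 0`, centre `x_c = 0`,
   `B = A`; `rss_pull_zero`): for `s < 0` and every `ρ`,
   `u(s, y) = e^ρ e^{−ρA} u(e^{2ρ}s, e^ρ e^{ρA} y)` (`rss_identity_of_generator`).
2. *Rotation.* For skew `A`, `e^{−A}` is a linear isometric isomorphism `L` of `ℝ³` with inverse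
   `e^{A}` (`rss_exists_rot`); with `c = e > 1` and `R = L⁻¹` step 1 at `ρ = 1` reads
   `c R⁻¹ u(c²t, cRx) = u(t, x)` for `t < 0`.
3. *Truncation.* The field `v = 𝟙_{t<0} u` (zero on `t ≥ 0`) is rotated `c`-DSS for ALL `t`
   (`IsRotatedDSS c R v`; both sides vanish for `t ≥ 0`), lies in `A_{2C}` (the class only looks
   into the past: `rss_isTypeIAncientMild_of_local` with `δ = 0`), hence is an ancient mild
   solution in the duality sense (`IsTypeIAncientMild.isAncientMildSolution`) with continuous,
   so a.e.-strongly measurable, slices, and inherits the Type-I space–time bound.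
4. *Conclusion.* `RotatedTypeIDSSLiouville c R` (the `R`-half of the conjecture at `c = e`) makes
   every slice `v(t) = u(t)`, `t < 0`, a.e. zero; a continuous slice a.e. equal to `0` is `0`
   (`Continuous.ae_eq_iff_eq`, Lebesgue measure charges open sets).

The hypothesis `A ≠ 0` of the registered statement is not used. No new definitions, no named
facts; trust base: the conjecture hypothesis and Mathlib's axioms.

## References

* Z. Bradshaw, T.-P. Tsai, Comm. PDE 42 (2017) = arXiv:1610.05680, §5, Open Problem 5.1.
  [BradshawTsai2017CPDE]
* T.-P. Tsai, *Lectures on Navier–Stokes equations*, GSM 192 (2018), Conjectures 8.8–8.9.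
* G. Koch, N. Nadirashvili, G. Seregin, V. Šverák, Acta Math. 203 (2009) 83–105, §1 (symmetries
  of the class), §6. [KochNadirashviliSereginSverak2009]
-/

noncomputable section

-- the summit and its single sub-problem share the name (CONVENTIONS §1), as in every Theorems file
set_option linter.dupNamespace false

open Set Function Filter MeasureTheory
open scoped Topology
open Literature.Analysis.FluidPDE

namespace Summit.NavierStokesRegularity.NavierStokesRegularity.Theorems.SymmetryModuliCountSymmetricLiouville

/-- Local notation for physical space `ℝ³`. -/
local notation "E3" => EuclideanSpace ℝ (Fin 3)

/-! ### Step 1: the clause integrates to exact rotated self-similarity -/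

/-- **Exact rotated self-similarity from the generator clause.** If `u ∈ A_C` is annihilated on
`t < 0` by `∇u·(x + Ax) + u + 2t∂ₜu − Au`, then for every `s < 0`, `y` and every group parameter
`ρ`, `u(s, y) = e^ρ e^{−ρA} u(e^{2ρ}s, e^ρ e^{ρA} y)` (rotated Euler homogeneity `rss_pull_const`
with vertex `0`, centre `0`, compared with the parameter `ρ = 0`, `rss_pull_zero`). -/
theorem rss_identity_of_generator {C : ℝ} {u : ℝ → E3 → E3} (hu : IsTypeIAncientMild C u)
    {A : E3 →L[ℝ] E3}
    (hL : ∀ t < 0, ∀ x, fderiv ℝ (u t) x (x + A x) + u t x + (2 * t) • timeDeriv u t x -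
      A (u t x) = 0)
    (ρ : ℝ) {s : ℝ} (hs : s < 0) (y : E3) :
    u s y = Real.exp ρ • NormedSpace.exp ((-ρ) • A)
      (u (Real.exp ρ ^ 2 * s) (Real.exp ρ • NormedSpace.exp (ρ • A) y)) := by
  have hd : DifferentiableOn ℝ (uncurry u) (Iio 0 ×ˢ univ) :=
    hu.contDiffOn.differentiableOn (by simp)
  have hgen : ∀ t < 0, ∀ x, fderiv ℝ (u t) x ((x - 0) + A (x - 0)) + u t x +
      (2 * (t - 0)) • timeDeriv u t x - A (u t x) = 0 := fun t ht x => by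
    simpa only [sub_zero] using hL t ht x
  have h₁ : (0 : ℝ) + Real.exp 0 ^ 2 * s < 0 := by simpa using hs
  have h₂ : (0 : ℝ) + Real.exp ρ ^ 2 * s < 0 := by
    rw [zero_add]
    exact mul_neg_of_pos_of_neg (by positivity) hs
  have key := rss_pull_const hd hgen y h₁ h₂
  rw [rss_pull_zero] at key
  simpa only [zero_add, sub_zero] using key

/-! ### Step 3: truncation to `t < 0` stays in the class -/

/-- **The class only looks into the past**: the truncation `v(t) = u(t)` for `t < 0`, `v(t) = 0`
for `t ≥ 0`, of an element of `A_C` lies in `A_{2C}` (gluing lemma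
`rss_isTypeIAncientMild_of_local` with shift `δ = 0` and `G = u` on every backward end). -/
theorem isTypeIAncientMild_truncate {C : ℝ} {u : ℝ → E3 → E3} (hu : IsTypeIAncientMild C u) :
    IsTypeIAncientMild (2 * C) (fun t => if t < 0 then u t else 0) := by
  refine rss_isTypeIAncientMild_of_local fun t₁ ht₁ ε hε =>
    ⟨0, u, le_rfl, hε, by simpa using ht₁, hu, fun s hs y => ?_⟩
  simp only [if_pos (hs.trans ht₁), add_zero]

/-! ### The bridge -/

/-- **Stub T7 — the bridge: `TypeIDSSLiouvilleConjecture` ⇒ the Type-I RSS core.** Under the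
canonical conjecture `TypeIDSSLiouvilleConjecture` (Bradshaw–Tsai 2017, Open Problem 5.1; Tsai
GSM 192, Conj. 8.8–8.9; hypothesis), an element `u ∈ A_C` annihilated on `t < 0` by the rotated
scaling generator `∇u·(x + Ax) + u + 2t∂ₜu − Au` (`A` skew) with a space–time Type-I bound
`HasTypeIDecay K u` vanishes on `t < 0`: the clause integrates to
`u(t,x) = e e^{−A} u(e²t, e e^{A} x)` (`rss_identity_of_generator` at `ρ = 1`), so the truncation
of `u` to `t < 0` is rotated `e`-DSS with the isometry `R = e^{A}` (`rss_exists_rot`), is an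
ancient mild solution in the duality sense (`isTypeIAncientMild_truncate`,
`IsTypeIAncientMild.isAncientMildSolution`) with a.e.-strongly measurable slices and the Type-I
bound; `RotatedTypeIDSSLiouville e R` makes every slice a.e. zero, and continuous slices a.e. zero
are zero. The hypothesis `A ≠ 0` is not used. CONDITIONAL on the conjecture hypothesis. -/
theorem stub_rssCoreOfConjecture :
    _root_.Summit.NavierStokesRegularity.NavierStokesRegularity.TypeIDSSLiouvilleConjecture →
    ∀ (C : ℝ) (u : ℝ → E3 → E3), IsTypeIAncientMild C u →
      ∀ A : E3 →L[ℝ] E3, (∀ x, inner ℝ (A x) x = 0) → A ≠ 0 →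
        (∀ t < 0, ∀ x, fderiv ℝ (u t) x (x + A x) + u t x + (2 * t) • timeDeriv u t x - A (u t x) = 0) →
        (∃ K : ℝ, HasTypeIDecay K u) → ∀ t < 0, ∀ x, u t x = 0 := by
  intro hConj C u hu A hA _ hL hK t ht x
  -- Step 2: the rotation `L = e^{-A}`, `L⁻¹ = e^{A}`; scaling factor `c = e > 1`
  obtain ⟨L, hL1, hL2⟩ := rss_exists_rot (E := E3) hA 1
  have hc1 : 1 < Real.exp 1 := Real.one_lt_exp_iff.2 one_pos
  -- Step 3: the truncation `v = 𝟙_{t<0} u`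
  obtain ⟨v, hv⟩ : ∃ v : ℝ → E3 → E3, v = fun s => if s < 0 then u s else 0 := ⟨_, rfl⟩
  have hv_neg : ∀ s < 0, v s = u s := fun s hs => by
    rw [hv]
    exact if_pos hs
  have hv_nonneg : ∀ s : ℝ, ¬ s < 0 → v s = 0 := fun s hs => by
    rw [hv]
    exact if_neg hs
  have hvclass : IsTypeIAncientMild (2 * C) v := hv ▸ isTypeIAncientMild_truncate hu
  -- `v` is rotated `e`-DSS with rotation `R = L⁻¹` for all times
  have hdss : IsRotatedDSS (Real.exp 1) L.symm v := by
    intro s y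
    rw [LinearIsometryEquiv.symm_symm]
    by_cases hs : s < 0
    · have hcs : Real.exp 1 ^ 2 * s < 0 := mul_neg_of_pos_of_neg (by positivity) hs
      rw [hv_neg s hs, hv_neg _ hcs, hL1, hL2]
      exact (rss_identity_of_generator hu hL 1 hs y).symm
    · have hcs : ¬ Real.exp 1 ^ 2 * s < 0 :=
        not_lt.2 (mul_nonneg (sq_nonneg _) (not_lt.1 hs))
      rw [hv_nonneg s hs, hv_nonneg _ hcs]
      simp
  -- measurable slices and the Type-I space–time bound
  have hmeas : ∀ s < 0, AEStronglyMeasurable (v s) volume := fun s hs =>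
    hvclass.aestronglyMeasurable_slice hs
  have hdec : ∃ K : ℝ, HasTypeIDecay K v := by
    obtain ⟨K, hKu⟩ := hK
    refine ⟨K, fun s hs y => ?_⟩
    rw [hv_neg s hs]
    exact hKu s hs y
  -- Step 4: the conjecture (its rotated half at `c = e`, `R = L⁻¹`) kills every slice a.e.
  have hae : v t =ᵐ[volume] 0 :=
    (hConj (Real.exp 1)).2 L.symm hc1 v hvclass.isAncientMildSolution hmeas hdss hdec t ht
  rw [hv_neg t ht] at hae
  have h0 : u t = 0 :=
    (Continuous.ae_eq_iff_eq volume (hu.continuous_slice ht) continuous_const).1 hae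
  exact congr_fun h0 x

end Summit.NavierStokesRegularity.NavierStokesRegularity.Theorems.SymmetryModuliCountSymmetricLiouville

end
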